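import Mathlib
import HarnessLib

/-!
# NE7EnvelopeSecondOrder — THE SECOND-ORDER ENVELOPE THEOREM: `m(y) = g(y, z⋆(y))` ALONG A `C¹` CRITICAL BRANCH OF A `C²` FUNCTION IS `C²`, ITS HESSIAN IS THE SCHUR COMPLEMENT
# `D²m(0)[v,w] = D²g(0)[(v, z⋆′v), (w, z⋆′w)]`, AND — when `D²_z g(0)` is positive semidefinite — `D²m(0)[v,v] = min_ζ D²g(0)[(v,ζ),(v,ζ)]` (ROAD-G115 §2, the abstract letter for
# «the Hessian of the constrained minimal action at the flat datum is the variational quadratic form of the averaging constraint», Bałaban's `Δ_k`)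

Pure calculus over real normed spaces `Y`, `K` ([folklore]; 0 def, 0 sorry): `fderiv_partial_snd`, `fderiv_fderiv_partial_snd` (the second derivative of `z ↦ g(0,z)` is the restriction
of `D²g(0)`), **`envelope_second_order`** (for `g : Y × K → ℝ` `C²` at `0`, `z⋆ : Y → K` `C¹` at `0` with `z⋆ 0 = 0` and `∂_z g(y, z⋆ y) = 0` near `0`: (i) `Dm(y) = ∂_y g(y, z⋆ y)` near `0`,
(ii) `m` is `C²` at `0` — one degree MORE than the chain rule gives —, (iii) the cross terms `D²g(0)[(v, z⋆′v), (0, ζ)]` vanish, (iv) the Hessian formula), **`hessian_le_of_psd`** ∕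
**`hessian_eq_min`** (the variational characterisation).  MECHANISM: `contDiffAt_succ_iff_hasFDerivAt` with the explicit derivative field `y ↦ Dg(y, z⋆ y)∘inl` (which is `C¹`);
differentiating the identities `Dm = Dg∘Γ∘inl` and `Dg∘Γ∘inr = 0` at `0`; symmetry of `D²g(0)` (`ContDiffAt.isSymmSndFDerivAt`).
Cell `pub-balaban`, rung (B)+1 sub-cell t4, lineage `b2b-balaban-t4-ne7-p1` (CRUX PROVER NE7 #1 = OWNER of BINDER row NE7), generation 115.  Memo `t4/b2b-balaban-t4-ne7-p1-g115/ROAD-G115.md` §2.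
HONEST FRAMING (page 1): a calculus letter; nothing of Bałaban's asserted; NOT NE7, NOT NE3; spine 0∕9; NOT infinite volume, NOT mass gap, NOT BetaPertH, NOT Clay.
-/

set_option autoImplicit false

open scoped Topology
open Filter Set ContinuousLinearMap

namespace Summit.QuantumFields.BalabanUV.T4Continuum.NE7EnvelopeSecondOrder

variable {Y K : Type*} [NormedAddCommGroup Y] [NormedSpace ℝ Y] [NormedAddCommGroup K] [NormedSpace ℝ K]

/-- The partial derivative in the second variable is the full derivative composed with `inr`. [folklore] -/
theorem fderiv_partial_snd {g : Y × K → ℝ} {y : Y} {z : K} (hg : DifferentiableAt ℝ g (y, z)) :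
    fderiv ℝ (fun z' : K => g (y, z')) z = (fderiv ℝ g (y, z)).comp (inr ℝ Y K) :=
  (hg.hasFDerivAt.comp z (hasFDerivAt_prodMk_right y z)).fderiv

/-- The partial derivative in the first variable is the full derivative composed with `inl`. [folklore] -/
theorem fderiv_partial_fst {g : Y × K → ℝ} {y : Y} {z : K} (hg : DifferentiableAt ℝ g (y, z)) :
    fderiv ℝ (fun y' : Y => g (y', z)) y = (fderiv ℝ g (y, z)).comp (inl ℝ Y K) :=
  (hg.hasFDerivAt.comp y (hasFDerivAt_prodMk_left y z)).fderiv

/-- The second derivative of the partial map `z ↦ g(0, z)` at `0` is the restriction of `D²g(0)` to `0 × K`. [folklore] -/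
theorem fderiv_fderiv_partial_snd {g : Y × K → ℝ} (hgc : ContDiffAt ℝ 2 g 0) (η η' : K) :
    fderiv ℝ (fderiv ℝ (fun z : K => g (0, z))) 0 η η' = fderiv ℝ (fderiv ℝ g) 0 ((0 : Y), η) ((0 : Y), η') := by
  have hgd : ∀ᶠ p : Y × K in 𝓝 0, DifferentiableAt ℝ g p :=
    (hgc.eventually (by simp)).mono fun p hp => hp.differentiableAt (by simp)
  have ht : Tendsto (fun z : K => ((0 : Y), z)) (𝓝 0) (𝓝 0) := by
    have h := (hasFDerivAt_prodMk_right (𝕜 := ℝ) (0 : Y) (0 : K)).continuousAt.tendsto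
    rwa [Prod.mk_zero_zero] at h
  have hev : fderiv ℝ (fun z : K => g (0, z)) =ᶠ[𝓝 0] (⇑((compL ℝ K (Y × K) ℝ).flip (inr ℝ Y K)) ∘ fun z : K => fderiv ℝ g ((0 : Y), z)) := by
    filter_upwards [ht.eventually hgd] with z hz
    rw [fderiv_partial_snd hz, Function.comp_apply, flip_apply, compL_apply]
  have hF : ContDiffAt ℝ 1 (fderiv ℝ g) 0 := hgc.fderiv_right (by norm_num)
  have hFd : HasFDerivAt (fderiv ℝ g) (fderiv ℝ (fderiv ℝ g) 0) ((fun z : K => ((0 : Y), z)) 0) := by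
    show HasFDerivAt (fderiv ℝ g) (fderiv ℝ (fderiv ℝ g) 0) ((0 : Y), (0 : K))
    rw [Prod.mk_zero_zero]; exact (hF.differentiableAt one_ne_zero).hasFDerivAt
  have hcomp : HasFDerivAt (fun z : K => fderiv ℝ g ((0 : Y), z)) ((fderiv ℝ (fderiv ℝ g) 0).comp (inr ℝ Y K)) 0 :=
    hFd.comp 0 (hasFDerivAt_prodMk_right (0 : Y) (0 : K))
  have hd := ((compL ℝ K (Y × K) ℝ).flip (inr ℝ Y K)).hasFDerivAt.comp 0 hcomp
  rw [hev.fderiv_eq, hd.fderiv]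
  simp only [ContinuousLinearMap.comp_apply, flip_apply, compL_apply, inr_apply]

/-- **THE SECOND-ORDER ENVELOPE THEOREM** (see the module docstring).  For `g : Y × K → ℝ` `C²` at `0` and a `C¹` critical branch `z⋆` (`z⋆ 0 = 0`, `∂_z g(y, z⋆ y) = 0` near `0`),
with `m y := g (y, z⋆ y)` and `Γ y := (y, z⋆ y)`: (i) `Dm(y) = Dg(Γ y)∘inl` near `0`; (ii) `m` is `C²` at `0`; (iii) `D²g(0)[(v, z⋆′(0)v), (0, ζ)] = 0`; (iv)
`D²m(0)[v, w] = D²g(0)[(v, z⋆′(0)v), (w, z⋆′(0)w)]`. [folklore] -/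
theorem envelope_second_order {g : Y × K → ℝ} {zs : Y → K} (hgc : ContDiffAt ℝ 2 g 0) (hzsc : ContDiffAt ℝ 1 zs 0) (hzs0 : zs 0 = 0)
    (hcrit : ∀ᶠ y : Y in 𝓝 0, fderiv ℝ (fun z : K => g (y, z)) (zs y) = 0) :
    (∀ᶠ y : Y in 𝓝 0, HasFDerivAt (fun y' : Y => g (y', zs y')) ((fderiv ℝ g (y, zs y)).comp (inl ℝ Y K)) y) ∧
    ContDiffAt ℝ 2 (fun y : Y => g (y, zs y)) 0 ∧
    (∀ (v : Y) (ζ : K), fderiv ℝ (fderiv ℝ g) 0 (v, fderiv ℝ zs 0 v) ((0 : Y), ζ) = 0) ∧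
    (∀ v w : Y, fderiv ℝ (fderiv ℝ (fun y : Y => g (y, zs y))) 0 v w = fderiv ℝ (fderiv ℝ g) 0 (v, fderiv ℝ zs 0 v) (w, fderiv ℝ zs 0 w)) := by
  -- differentiability near `0`
  have hgd : ∀ᶠ p : Y × K in 𝓝 0, DifferentiableAt ℝ g p :=
    (hgc.eventually (by simp)).mono fun p hp => hp.differentiableAt (by simp)
  have hzsd : ∀ᶠ y : Y in 𝓝 0, HasFDerivAt zs (fderiv ℝ zs y) y :=
    (hzsc.eventually (by simp)).mono fun y hy => (hy.differentiableAt one_ne_zero).hasFDerivAt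
  have hΓc : ContDiffAt ℝ 1 (fun y : Y => (y, zs y)) 0 := contDiffAt_id.prodMk hzsc
  have hΓ0 : (fun y : Y => (y, zs y)) 0 = 0 := by simp only [hzs0, Prod.mk_zero_zero]
  have hΓt : Tendsto (fun y : Y => (y, zs y)) (𝓝 0) (𝓝 0) := by
    have h := hΓc.continuousAt.tendsto; rwa [hzs0, Prod.mk_zero_zero] at h
  -- (i) the first-order envelope formula near `0`
  have h1 : ∀ᶠ y : Y in 𝓝 0, HasFDerivAt (fun y' : Y => g (y', zs y')) ((fderiv ℝ g (y, zs y)).comp (inl ℝ Y K)) y := by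
    filter_upwards [hΓt.eventually hgd, hzsd, hcrit] with y hgy hzy hcy
    have hc : HasFDerivAt (fun y' : Y => g (y', zs y')) ((fderiv ℝ g (y, zs y)).comp ((ContinuousLinearMap.id ℝ Y).prod (fderiv ℝ zs y))) y :=
      hgy.hasFDerivAt.comp y ((hasFDerivAt_id y).prodMk hzy)
    have hinr : (fderiv ℝ g (y, zs y)).comp (inr ℝ Y K) = 0 := by rw [← fderiv_partial_snd hgy]; exact hcy
    have h0 : ∀ ζ : K, fderiv ℝ g (y, zs y) ((0 : Y), ζ) = 0 := fun ζ => by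
      have h := congrArg (fun T : K →L[ℝ] ℝ => T ζ) hinr
      simpa only [ContinuousLinearMap.comp_apply, inr_apply, zero_apply] using h
    have heq : (fderiv ℝ g (y, zs y)).comp ((ContinuousLinearMap.id ℝ Y).prod (fderiv ℝ zs y)) = (fderiv ℝ g (y, zs y)).comp (inl ℝ Y K) := by
      ext v
      simp only [ContinuousLinearMap.comp_apply, ContinuousLinearMap.prod_apply, ContinuousLinearMap.id_apply, inl_apply]
      calc fderiv ℝ g (y, zs y) (v, fderiv ℝ zs y v) = fderiv ℝ g (y, zs y) ((v, (0 : K)) + ((0 : Y), fderiv ℝ zs y v)) := by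
            rw [Prod.mk_add_mk, add_zero, zero_add]
        _ = fderiv ℝ g (y, zs y) (v, (0 : K)) := by rw [map_add, h0, add_zero]
    rw [heq] at hc; exact hc
  -- (ii) `C²`: the derivative field `y ↦ Dg(Γ y)∘inl` is `C¹` at `0`
  have hF : ContDiffAt ℝ 1 (fderiv ℝ g) 0 := hgc.fderiv_right (by norm_num)
  have hFΓ : ContDiffAt ℝ 1 (fun y : Y => fderiv ℝ g (y, zs y)) 0 := by
    have hF' : ContDiffAt ℝ 1 (fderiv ℝ g) ((fun y : Y => (y, zs y)) 0) := by rw [hΓ0]; exact hF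
    exact hF'.comp 0 hΓc
  have hf'c : ContDiffAt ℝ 1 (fun y : Y => (fderiv ℝ g (y, zs y)).comp (inl ℝ Y K)) 0 := hFΓ.clm_comp contDiffAt_const
  have h2 : ContDiffAt ℝ 2 (fun y : Y => g (y, zs y)) 0 := by
    obtain ⟨u, hu, hu'⟩ := Filter.eventually_iff_exists_mem.mp h1
    exact (contDiffAt_succ_iff_hasFDerivAt (n := 1)).mpr ⟨fun y : Y => (fderiv ℝ g (y, zs y)).comp (inl ℝ Y K), ⟨u, hu, hu'⟩, hf'c⟩
  -- derivatives at `0` of `y ↦ Dg(Γ y)∘inl` and of `y ↦ Dg(Γ y)∘inr ≡ 0`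
  have hΓd0 : HasFDerivAt (fun y : Y => (y, zs y)) ((ContinuousLinearMap.id ℝ Y).prod (fderiv ℝ zs 0)) 0 :=
    (hasFDerivAt_id (0 : Y)).prodMk (hzsc.differentiableAt one_ne_zero).hasFDerivAt
  have hFd : HasFDerivAt (fderiv ℝ g) (fderiv ℝ (fderiv ℝ g) 0) ((fun y : Y => (y, zs y)) 0) := by
    rw [hΓ0]; exact (hF.differentiableAt one_ne_zero).hasFDerivAt
  have hcomp : HasFDerivAt (fun y : Y => fderiv ℝ g (y, zs y)) ((fderiv ℝ (fderiv ℝ g) 0).comp ((ContinuousLinearMap.id ℝ Y).prod (fderiv ℝ zs 0))) 0 :=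
    hFd.comp 0 hΓd0
  have hdl := ((compL ℝ Y (Y × K) ℝ).flip (inl ℝ Y K)).hasFDerivAt.comp 0 hcomp
  have hdr := ((compL ℝ K (Y × K) ℝ).flip (inr ℝ Y K)).hasFDerivAt.comp 0 hcomp
  have hfl : (fun y : Y => (fderiv ℝ g (y, zs y)).comp (inl ℝ Y K)) = (⇑((compL ℝ Y (Y × K) ℝ).flip (inl ℝ Y K)) ∘ fun y : Y => fderiv ℝ g (y, zs y)) := by
    funext y; simp only [Function.comp_apply, flip_apply, compL_apply]
  have hfr : (fun y : Y => (fderiv ℝ g (y, zs y)).comp (inr ℝ Y K)) = (⇑((compL ℝ K (Y × K) ℝ).flip (inr ℝ Y K)) ∘ fun y : Y => fderiv ℝ g (y, zs y)) := by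
    funext y; simp only [Function.comp_apply, flip_apply, compL_apply]
  -- (iii) the cross terms vanish: `y ↦ Dg(Γ y)∘inr` is eventually `0`
  have hPz : (fun y : Y => (fderiv ℝ g (y, zs y)).comp (inr ℝ Y K)) =ᶠ[𝓝 0] fun _ : Y => (0 : K →L[ℝ] ℝ) := by
    filter_upwards [hΓt.eventually hgd, hcrit] with y hgy hcy
    rw [← fderiv_partial_snd hgy]; exact hcy
  have h3 : ∀ (v : Y) (ζ : K), fderiv ℝ (fderiv ℝ g) 0 (v, fderiv ℝ zs 0 v) ((0 : Y), ζ) = 0 := by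
    intro v ζ
    have hD : fderiv ℝ (fun y : Y => (fderiv ℝ g (y, zs y)).comp (inr ℝ Y K)) 0 = 0 := by
      rw [hPz.fderiv_eq, fderiv_const_apply]
    rw [hfr, hdr.fderiv] at hD
    have h := congrArg (fun T : Y →L[ℝ] (K →L[ℝ] ℝ) => T v ζ) hD
    simpa only [ContinuousLinearMap.comp_apply, flip_apply, compL_apply, ContinuousLinearMap.prod_apply, ContinuousLinearMap.id_apply, inr_apply,
      zero_apply] using h
  -- (iv) the Hessian formula
  have hDm : fderiv ℝ (fun y : Y => g (y, zs y)) =ᶠ[𝓝 0] fun y : Y => (fderiv ℝ g (y, zs y)).comp (inl ℝ Y K) := h1.mono fun y hy => hy.fderiv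
  have h4 : ∀ v w : Y, fderiv ℝ (fderiv ℝ (fun y : Y => g (y, zs y))) 0 v w = fderiv ℝ (fderiv ℝ g) 0 (v, fderiv ℝ zs 0 v) (w, fderiv ℝ zs 0 w) := by
    intro v w
    rw [hDm.fderiv_eq, hfl, hdl.fderiv]
    simp only [ContinuousLinearMap.comp_apply, flip_apply, compL_apply, ContinuousLinearMap.prod_apply, ContinuousLinearMap.id_apply, inl_apply]
    calc fderiv ℝ (fderiv ℝ g) 0 (v, fderiv ℝ zs 0 v) (w, (0 : K))
        = fderiv ℝ (fderiv ℝ g) 0 (v, fderiv ℝ zs 0 v) (w, (0 : K)) + fderiv ℝ (fderiv ℝ g) 0 (v, fderiv ℝ zs 0 v) ((0 : Y), fderiv ℝ zs 0 w) := by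
          rw [h3, add_zero]
      _ = fderiv ℝ (fderiv ℝ g) 0 (v, fderiv ℝ zs 0 v) (w, fderiv ℝ zs 0 w) := by rw [← map_add, Prod.mk_add_mk, add_zero, zero_add]
  exact ⟨h1, h2, h3, h4⟩

/-- **THE HESSIAN OF THE MINIMUM IS BELOW THE HESSIAN ALONG ANY COMPETITOR** (see the module docstring): under the hypotheses of `envelope_second_order` and positive
SEMI-definiteness of `D²g(0)` on `0 × K`, `D²m(0)[v, v] ≤ D²g(0)[(v, ζ), (v, ζ)]` for every `ζ`. [folklore] -/
theorem hessian_le_of_psd {g : Y × K → ℝ} {zs : Y → K} (hgc : ContDiffAt ℝ 2 g 0) (hzsc : ContDiffAt ℝ 1 zs 0) (hzs0 : zs 0 = 0)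
    (hcrit : ∀ᶠ y : Y in 𝓝 0, fderiv ℝ (fun z : K => g (y, z)) (zs y) = 0)
    (hpsd : ∀ η : K, 0 ≤ fderiv ℝ (fderiv ℝ g) 0 ((0 : Y), η) ((0 : Y), η)) (v : Y) (ζ : K) :
    fderiv ℝ (fderiv ℝ (fun y : Y => g (y, zs y))) 0 v v ≤ fderiv ℝ (fderiv ℝ g) 0 (v, ζ) (v, ζ) := by
  obtain ⟨-, -, h3, h4⟩ := envelope_second_order hgc hzsc hzs0 hcrit
  have hsymm : IsSymmSndFDerivAt ℝ g 0 := hgc.isSymmSndFDerivAt (by simp)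
  set B := fderiv ℝ (fderiv ℝ g) 0 with hB
  set a : Y × K := (v, fderiv ℝ zs 0 v) with ha
  set e : Y × K := ((0 : Y), ζ - fderiv ℝ zs 0 v) with he
  have hsplit : ((v, ζ) : Y × K) = a + e := by rw [ha, he, Prod.mk_add_mk, add_zero, add_sub_cancel]
  have hae : B a e = 0 := h3 v _
  have hea : B e a = 0 := by rw [hsymm.eq e a]; exact hae
  have hexp : B (a + e) (a + e) = B a a + B e e := by
    rw [map_add, map_add, add_apply, add_apply, hae, hea, add_zero, zero_add]
  rw [h4, ← ha, hsplit, hexp]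
  have hee : 0 ≤ B e e := hpsd _
  linarith

/-- **VARIATIONAL CHARACTERISATION OF THE HESSIAN OF THE MINIMUM** (see the module docstring): `D²m(0)[v,v] = D²g(0)[(v, ζ⋆), (v, ζ⋆)]` with `ζ⋆ = z⋆′(0)v`, and this is
the MINIMUM of `ζ ↦ D²g(0)[(v, ζ), (v, ζ)]`. [folklore] -/
theorem hessian_eq_min {g : Y × K → ℝ} {zs : Y → K} (hgc : ContDiffAt ℝ 2 g 0) (hzsc : ContDiffAt ℝ 1 zs 0) (hzs0 : zs 0 = 0)
    (hcrit : ∀ᶠ y : Y in 𝓝 0, fderiv ℝ (fun z : K => g (y, z)) (zs y) = 0)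
    (hpsd : ∀ η : K, 0 ≤ fderiv ℝ (fderiv ℝ g) 0 ((0 : Y), η) ((0 : Y), η)) (v : Y) :
    IsLeast {q : ℝ | ∃ ζ : K, q = fderiv ℝ (fderiv ℝ g) 0 (v, ζ) (v, ζ)} (fderiv ℝ (fderiv ℝ (fun y : Y => g (y, zs y))) 0 v v) := by
  refine ⟨⟨fderiv ℝ zs 0 v, (envelope_second_order hgc hzsc hzs0 hcrit).2.2.2 v v⟩, ?_⟩
  rintro q ⟨ζ, rfl⟩
  exact hessian_le_of_psd hgc hzsc hzs0 hcrit hpsd v ζ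

end Summit.QuantumFields.BalabanUV.T4Continuum.NE7EnvelopeSecondOrder
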